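import Literature.MathematicalPhysics.KineticTheory.SiteChainConfinedDrift
import Mathlib.Analysis.ODE.Gronwall
import HarnessLib

/-!
# Site-inhomogeneous chains driven by a momentum-noise path: the pathwise energy identity and Grönwall

Topic `Literature/MathematicalPhysics/KineticTheory`, grouping namespace `…KineticTheory.HeatConduction`.
Twin, for the SITE-DEPENDENT chains `SiteChain` of `CellChain.lean` (drift `SiteChain.langevinDrift`,
`SiteChainConfined.lean`), of the generic half of `PureQuarticPathwiseEnergy.lean` /
`LangevinChainEnergyScale.lean` (written for `OscillatorChain`). Cuneo–Eckmann–Hairer–Rey-Bellet,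
EJP **23** (2018) no. 55, §3 eq. (3.3) (`LH = ∑_b γ_b (T_b - p_b²)`) and §5 p. 11 ("the main
contribution to the energy difference comes from (minus) the dissipation integral"): along ANY
continuous path `z` solving the integral equation of the chain driven by a momentum-noise path `η`,

  `z(t) = x + (0, η(t)) + ∫₀ᵗ Y(z(s)) ds` on `[0, T]`  (`IsIntegralSolutionOn`, `Y = P.langevinDrift N`),

the smooth part `y = z - (0, η)` is `C¹` with `y' = Y(z) = Y(y.1, y.2 + η)`, so that

* `SiteChain.hamiltonian_smoothPart_eq_add_integral` — `H(y(t)) = H(x) + ∫₀ᵗ (W - γ D)` with the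
  forcing work density `W = ∑_i (∂_{q_i}H(y) - γ w_i ȳ_i) η_i` and the dissipation density
  `D = ∑_i w_i ȳ_i²` (`w_i = [i = 0] + [i = N-1]`, `ȳ = y.2`);
* `SiteChain.hamiltonian_eq_sub_dissipation_add_work` — the bookkeeping identity
  `H(z(t)) = H(x) - γ∫₀ᵗ D + ∫₀ᵗ W + ∑_i (ȳ_i η_i + η_i²/2)(t)`;
* `SiteChain.hamiltonian_smoothPart_add_le_mul_exp` — **Grönwall**: if
  `∑_i |∂_{q_i}H| + 2γ ∑_i |p_i| ≤ a (H + d)` everywhere and `‖η‖ ≤ M` on `[0, T]`, then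
  `H(y(t)) + d ≤ (H(x) + d) e^{a M t}` on `[0, T]`;
* `SiteChain.abs_sum_work_le` — `|W| ≤ ‖η‖ (∑_i |∂_{q_i}H(y)| + 2γ ∑_i |ȳ_i|)`, and the elementary
  `abs_sum_mul_add_sq_half_le` — `|∑_i (p_i e_i + e_i²/2)| ≤ N M (B + M/2)`;
* for a uniformly confining chain, the model-free flow `drivenFlow (P.langevinDrift N) x (0, η)` of
  `ConfinedForcedFlow.lean` is such a path (`UniformlyConfining.isIntegralSolutionOn_drivenFlow`,
  `continuous_drivenFlow`).

Everything is PROVED; no definition, no named fact.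

## References

* N. Cuneo, J.-P. Eckmann, M. Hairer, L. Rey-Bellet, *Non-equilibrium steady states for networks of
  oscillators*, Electron. J. Probab. **23** (2018) no. 55 (arXiv:1712.09413), §3 eq. (3.3), §5 p. 11.
* R. Khasminskii, *Stochastic Stability of Differential Equations* (2nd ed., 2012), Thm 3.5.
-/

noncomputable section

open MeasureTheory Filter Topology Set Metric
open scoped NNReal

namespace Literature.MathematicalPhysics.KineticTheory.HeatConduction

open Literature.MathematicalPhysics.KineticTheory Literature.Analysis.ODE

variable {N : ℕ}

/-! ### Two elementary bounds -/

/-- `|∑_i (p_i e_i + e_i²/2)| ≤ N M (B + M/2)` when `|p_i| ≤ B` and `‖e‖ ≤ M` (the energy cost of a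
momentum translation of size `M` at momenta of size `B`). [folklore] -/
theorem abs_sum_mul_add_sq_half_le {p e : Fin N → ℝ} {B M : ℝ} (hp : ∀ i, |p i| ≤ B)
    (he : ‖e‖ ≤ M) : |∑ i, (p i * e i + e i ^ 2 / 2)| ≤ N * M * (B + M / 2) := by
  have hei : ∀ i, |e i| ≤ M := fun i =>
    (show |e i| ≤ ‖e‖ by rw [← Real.norm_eq_abs]; exact norm_le_pi_norm e i).trans he
  have hterm : ∀ i, |p i * e i + e i ^ 2 / 2| ≤ M * (B + M / 2) := by
    intro i
    have h1 : |p i * e i| ≤ B * M := by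
      rw [abs_mul]
      exact mul_le_mul (hp i) (hei i) (abs_nonneg _) ((abs_nonneg _).trans (hp i))
    have h2 : |e i ^ 2 / 2| ≤ M * M / 2 := by
      rw [abs_div, abs_pow, abs_two]
      have := mul_le_mul (hei i) (hei i) (abs_nonneg _) ((abs_nonneg _).trans (hei i))
      nlinarith
    calc |p i * e i + e i ^ 2 / 2| ≤ |p i * e i| + |e i ^ 2 / 2| := abs_add_le _ _
      _ ≤ B * M + M * M / 2 := add_le_add h1 h2
      _ = M * (B + M / 2) := by ring
  calc |∑ i, (p i * e i + e i ^ 2 / 2)| ≤ ∑ i, |p i * e i + e i ^ 2 / 2| :=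
        Finset.abs_sum_le_sum_abs _ _
    _ ≤ ∑ _i : Fin N, M * (B + M / 2) := Finset.sum_le_sum fun i _ => hterm i
    _ = N * M * (B + M / 2) := by
        simp only [Finset.sum_const, Finset.card_univ, Fintype.card_fin, nsmul_eq_mul]
        ring

namespace SiteChain

variable (P : SiteChain)

/-- **The forcing work is controlled by the force and the momenta**:
`|∑_i (∂_{q_i}H(y) - γ w_i ȳ_i) e_i| ≤ ‖e‖ (∑_i |∂_{q_i}H(y)| + 2γ ∑_i |ȳ_i|)` (`γ ≥ 0`,
`w_i ∈ [0, 2]`). [folklore] -/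
theorem abs_sum_work_le (hγ : 0 ≤ P.γ) (y : PhaseSpace N) (e : Fin N → ℝ) :
    |∑ i, (partialQ i (P.hamiltonian N) y - P.γ * OscillatorChain.bathWeight N i * y.2 i) * e i| ≤
      ‖e‖ * ((∑ i, |partialQ i (P.hamiltonian N) y|) + 2 * P.γ * ∑ i, |y.2 i|) := by
  refine (Finset.abs_sum_le_sum_abs _ _).trans ?_
  have hei : ∀ i, |e i| ≤ ‖e‖ := fun i => by rw [← Real.norm_eq_abs]; exact norm_le_pi_norm e i
  have hw0 : ∀ i, 0 ≤ OscillatorChain.bathWeight N i := fun i => by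
    unfold OscillatorChain.bathWeight; split_ifs <;> norm_num
  have hw2 : ∀ i, OscillatorChain.bathWeight N i ≤ 2 := fun i => by
    unfold OscillatorChain.bathWeight; split_ifs <;> norm_num
  have hterm : ∀ i, |(partialQ i (P.hamiltonian N) y - P.γ * OscillatorChain.bathWeight N i * y.2 i) * e i| ≤
      (|partialQ i (P.hamiltonian N) y| + 2 * P.γ * |y.2 i|) * ‖e‖ := by
    intro i
    rw [abs_mul]
    refine mul_le_mul ?_ (hei i) (abs_nonneg _) (by positivity)
    refine (abs_sub _ _).trans (add_le_add le_rfl ?_)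
    rw [abs_mul, abs_mul, abs_of_nonneg hγ, abs_of_nonneg (hw0 i)]
    have : P.γ * OscillatorChain.bathWeight N i * |y.2 i| ≤ P.γ * 2 * |y.2 i| := by
      have := hw2 i
      gcongr
    linarith
  calc ∑ i, |(partialQ i (P.hamiltonian N) y - P.γ * OscillatorChain.bathWeight N i * y.2 i) * e i|
      ≤ ∑ i, (|partialQ i (P.hamiltonian N) y| + 2 * P.γ * |y.2 i|) * ‖e‖ :=
        Finset.sum_le_sum fun i _ => hterm i
    _ = ‖e‖ * ((∑ i, |partialQ i (P.hamiltonian N) y|) + 2 * P.γ * ∑ i, |y.2 i|) := by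
        rw [← Finset.sum_mul, Finset.sum_add_distrib, Finset.mul_sum, mul_comm]

/-! ### The drift and the energy derivative -/

/-- The Langevin drift is continuous for `C¹` potentials. [folklore] -/
theorem continuous_langevinDrift_of_contDiff (hU : ∀ i, ContDiff ℝ 1 (P.U i))
    (hV : ∀ i, ContDiff ℝ 1 (P.V i)) (N : ℕ) : Continuous (P.langevinDrift N) := by
  have hH : ContDiff ℝ 1 (P.hamiltonian N) := P.contDiff_hamiltonian N hU hV
  unfold langevinDrift
  refine continuous_snd.prodMk (continuous_pi fun i => ?_)
  exact (continuous_partialQ hH one_ne_zero i).neg.sub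
    (continuous_const.mul ((continuous_apply i).comp continuous_snd))

/-- **The energy derivative in work–dissipation form**: for the Langevin drift `Y` and a momentum
perturbation `e`, `DH(y)·Y(y.1, y.2 + e) = ∑_i (∂_{q_i}H(y) - γ w_i p_i) e_i - γ ∑_i w_i p_i²`.
[cite: CuneoEckmannHairerReyBellet2018, §3 eq. (3.3)] -/
theorem fderiv_hamiltonian_drift_eq_work_sub (hU : ∀ i, ContDiff ℝ 1 (P.U i))
    (hV : ∀ i, ContDiff ℝ 1 (P.V i)) (y : PhaseSpace N) (e : Fin N → ℝ) :
    fderiv ℝ (P.hamiltonian N) y (P.langevinDrift N (y.1, y.2 + e)) =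
      (∑ i, (partialQ i (P.hamiltonian N) y - P.γ * OscillatorChain.bathWeight N i * y.2 i) * e i) -
        P.γ * ∑ i, OscillatorChain.bathWeight N i * y.2 i ^ 2 := by
  rw [P.fderiv_hamiltonian_drift_eq_sum hU hV, Finset.mul_sum, ← Finset.sum_sub_distrib]
  exact Finset.sum_congr rfl fun i _ => by ring

/-! ### Solutions of the driven integral equation: the smooth part -/

/-- The smooth part `y = z - (0, η)` of a solution of `z(t) = x + (0, η(t)) + ∫₀ᵗ Y(z)` is
`x + ∫₀ᵗ Y(z)` (`Y = P.langevinDrift N`). [folklore] -/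
theorem smoothPart_eq_add_integral {x : PhaseSpace N} {η : ℝ → Fin N → ℝ} {z : ℝ → PhaseSpace N}
    {T : ℝ} (hz : IsIntegralSolutionOn (P.langevinDrift N) (fun t => x + ((0 : Fin N → ℝ), η t)) z T)
    {t : ℝ} (ht : t ∈ Icc 0 T) :
    z t - ((0 : Fin N → ℝ), η t) = x + ∫ s in (0 : ℝ)..t, P.langevinDrift N (z s) := by
  rw [hz t ht]
  ext i
  · simp
  · simp
    ring

/-- **The energy identity of the smooth part** (pathwise form of CEHR (3.3)): for `C¹` potentials,
a continuous solution `z` of `z(t) = x + (0, η(t)) + ∫₀ᵗ Y(z)` on `[0, T]` and `y = z - (0, η)`,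
`H(y(t)) = H(x) + ∫₀ᵗ (∑_i (∂_{q_i}H(y) - γ w_i ȳ_i) η_i - γ ∑_i w_i ȳ_i²) ds` on `[0, T]`.
[cite: CuneoEckmannHairerReyBellet2018, §3 eq. (3.3) and §5 p. 11] -/
theorem hamiltonian_smoothPart_eq_add_integral (hU : ∀ i, ContDiff ℝ 1 (P.U i))
    (hV : ∀ i, ContDiff ℝ 1 (P.V i)) {x : PhaseSpace N} {η : ℝ → Fin N → ℝ}
    {z : ℝ → PhaseSpace N} (hzc : Continuous z) {T : ℝ}
    (hz : IsIntegralSolutionOn (P.langevinDrift N) (fun t => x + ((0 : Fin N → ℝ), η t)) z T)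
    {t : ℝ} (ht : t ∈ Icc 0 T) :
    P.hamiltonian N (z t - ((0 : Fin N → ℝ), η t)) = P.hamiltonian N x +
      ∫ s in (0 : ℝ)..t,
        ((∑ i, (partialQ i (P.hamiltonian N) (z s - ((0 : Fin N → ℝ), η s)) -
            P.γ * OscillatorChain.bathWeight N i * (z s - ((0 : Fin N → ℝ), η s)).2 i) * η s i) -
          P.γ * ∑ i, OscillatorChain.bathWeight N i * (z s - ((0 : Fin N → ℝ), η s)).2 i ^ 2) := by
  set H := P.hamiltonian N with hHdef
  set Y := P.langevinDrift N with hYdef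
  have hH1 : ContDiff ℝ 1 H := P.contDiff_hamiltonian N hU hV
  have hHd : Differentiable ℝ H := hH1.differentiable one_ne_zero
  have hYc : Continuous Y := P.continuous_langevinDrift_of_contDiff hU hV N
  set y : ℝ → PhaseSpace N := fun s => x + ∫ r in (0 : ℝ)..s, Y (z r) with hydef
  have hy_deriv : ∀ s, HasDerivAt y (Y (z s)) s := fun s => by
    have h1 : HasDerivAt (fun u => ∫ r in (0 : ℝ)..u, Y (z r)) (Y (z s)) s :=
      ((hYc.comp hzc).integral_hasStrictDerivAt 0 s).hasDerivAt
    exact h1.const_add x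
  have hyc : Continuous y := continuous_iff_continuousAt.2 fun s => (hy_deriv s).continuousAt
  have hy_eq : ∀ s ∈ Icc 0 T, y s = z s - ((0 : Fin N → ℝ), η s) := fun s hs =>
    (P.smoothPart_eq_add_integral hz hs).symm
  have hz_y : ∀ s ∈ Icc 0 T, z s = ((y s).1, (y s).2 + η s) := fun s hs => by
    rw [hy_eq s hs]
    ext i <;> simp
  -- the derivative of the energy of the smooth part
  set ψ : ℝ → ℝ := fun s => fderiv ℝ H (y s) (Y (z s)) with hψ
  have hg_deriv : ∀ s, HasDerivAt (fun s => H (y s)) (ψ s) s := fun s =>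
    (hHd (y s)).hasFDerivAt.comp_hasDerivAt s (hy_deriv s)
  have hψc : Continuous ψ := ((hH1.continuous_fderiv one_ne_zero).comp hyc).clm_apply (hYc.comp hzc)
  have hψ_eq : ∀ s ∈ Icc 0 T, ψ s =
      (∑ i, (partialQ i H (y s) - P.γ * OscillatorChain.bathWeight N i * (y s).2 i) * η s i) -
        P.γ * ∑ i, OscillatorChain.bathWeight N i * (y s).2 i ^ 2 := by
    intro s hs
    simp only [hψ]
    rw [hz_y s hs]
    exact P.fderiv_hamiltonian_drift_eq_work_sub hU hV (y s) (η s)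
  -- the fundamental theorem of calculus
  have hFTC : ∫ s in (0 : ℝ)..t, ψ s = H (y t) - H (y 0) :=
    intervalIntegral.integral_eq_sub_of_hasDerivAt (fun s _ => hg_deriv s) (hψc.intervalIntegrable 0 t)
  have hy0 : y 0 = x := by simp [hydef]
  have hcongr : ∫ s in (0 : ℝ)..t, ψ s = ∫ s in (0 : ℝ)..t,
      ((∑ i, (partialQ i H (z s - ((0 : Fin N → ℝ), η s)) -
          P.γ * OscillatorChain.bathWeight N i * (z s - ((0 : Fin N → ℝ), η s)).2 i) * η s i) -
        P.γ * ∑ i, OscillatorChain.bathWeight N i * (z s - ((0 : Fin N → ℝ), η s)).2 i ^ 2) :=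
    intervalIntegral.integral_congr fun s hs => by
      have hs' : s ∈ Icc 0 T := by
        rw [uIcc_of_le ht.1] at hs
        exact ⟨hs.1, hs.2.trans ht.2⟩
      rw [hψ_eq s hs', hy_eq s hs']
  rw [← hy_eq t ht, ← hcongr, hFTC, hy0]
  ring

/-- **The energy bookkeeping along a driven path** (CEHR (3.3), pathwise, the noise momentum `η` in
place of Itô's correction): for `C¹` potentials, a continuous `η`, a continuous solution `z` of
`z(t) = x + (0, η(t)) + ∫₀ᵗ Y(z)` on `[0, T]` and `y = z - (0, η)`,
`H(z(t)) = H(x) - γ∫₀ᵗ ∑_i w_i ȳ_i² + ∫₀ᵗ ∑_i (∂_{q_i}H(y) - γ w_i ȳ_i) η_i + ∑_i (ȳ_i(t)η_i(t) + η_i(t)²/2)`.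
[cite: CuneoEckmannHairerReyBellet2018, §3 eq. (3.3) and §5 p. 11] -/
theorem hamiltonian_eq_sub_dissipation_add_work (hU : ∀ i, ContDiff ℝ 1 (P.U i))
    (hV : ∀ i, ContDiff ℝ 1 (P.V i)) {x : PhaseSpace N} {η : ℝ → Fin N → ℝ} (hη : Continuous η)
    {z : ℝ → PhaseSpace N} (hzc : Continuous z) {T : ℝ}
    (hz : IsIntegralSolutionOn (P.langevinDrift N) (fun t => x + ((0 : Fin N → ℝ), η t)) z T)
    {t : ℝ} (ht : t ∈ Icc 0 T) :
    P.hamiltonian N (z t) = P.hamiltonian N x -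
        P.γ * (∫ s in (0 : ℝ)..t, ∑ i, OscillatorChain.bathWeight N i *
          (z s - ((0 : Fin N → ℝ), η s)).2 i ^ 2) +
        (∫ s in (0 : ℝ)..t, ∑ i, (partialQ i (P.hamiltonian N) (z s - ((0 : Fin N → ℝ), η s)) -
            P.γ * OscillatorChain.bathWeight N i * (z s - ((0 : Fin N → ℝ), η s)).2 i) * η s i) +
        ∑ i, ((z t - ((0 : Fin N → ℝ), η t)).2 i * η t i + η t i ^ 2 / 2) := by
  set H := P.hamiltonian N with hHdef
  have hH1 : ContDiff ℝ 1 H := P.contDiff_hamiltonian N hU hV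
  -- continuity of the two integrands
  have hyc : Continuous fun s => z s - ((0 : Fin N → ℝ), η s) := hzc.sub (continuous_const.prodMk hη)
  have hQc : ∀ i, Continuous fun s => partialQ i H (z s - ((0 : Fin N → ℝ), η s)) := fun i =>
    (continuous_partialQ hH1 one_ne_zero i).comp hyc
  have hy2c : ∀ i, Continuous fun s => (z s - ((0 : Fin N → ℝ), η s)).2 i := fun i =>
    (continuous_apply i).comp (continuous_snd.comp hyc)
  have hηc : ∀ i, Continuous fun s => η s i := fun i => (continuous_apply i).comp hη
  set W : ℝ → ℝ := fun s => ∑ i, (partialQ i H (z s - ((0 : Fin N → ℝ), η s)) -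
    P.γ * OscillatorChain.bathWeight N i * (z s - ((0 : Fin N → ℝ), η s)).2 i) * η s i with hW
  set Dis : ℝ → ℝ := fun s => ∑ i, OscillatorChain.bathWeight N i *
    (z s - ((0 : Fin N → ℝ), η s)).2 i ^ 2 with hDis
  have hWc : Continuous W := by
    simp only [hW]
    exact continuous_finsetSum _ fun i _ =>
      ((hQc i).sub (continuous_const.mul (hy2c i))).mul (hηc i)
  have hDisc : Continuous Dis := by
    simp only [hDis]
    exact continuous_finsetSum _ fun i _ => continuous_const.mul ((hy2c i).pow 2)
  -- the identity for the smooth part, split into work and dissipation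
  have hid := P.hamiltonian_smoothPart_eq_add_integral hU hV hzc hz ht
  have hsplit : ∫ s in (0 : ℝ)..t, (W s - P.γ * Dis s) =
      (∫ s in (0 : ℝ)..t, W s) - P.γ * ∫ s in (0 : ℝ)..t, Dis s := by
    rw [intervalIntegral.integral_sub (hWc.intervalIntegrable _ _)
        ((hDisc.const_mul P.γ).intervalIntegrable _ _),
      intervalIntegral.integral_const_mul]
  -- the total energy at time `t` is that of the smooth part plus the momentum shift
  have hzt : H (z t) = H (z t - ((0 : Fin N → ℝ), η t)) +
      ∑ i, ((z t - ((0 : Fin N → ℝ), η t)).2 i * η t i + η t i ^ 2 / 2) := by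
    have h := P.hamiltonian_momentum_shift N (z t - ((0 : Fin N → ℝ), η t)).1
      (z t - ((0 : Fin N → ℝ), η t)).2 (η t)
    have e : ((z t - ((0 : Fin N → ℝ), η t)).1, (z t - ((0 : Fin N → ℝ), η t)).2 + η t) = z t := by
      ext i <;> simp
    rw [e] at h
    linarith
  change H (z t) = H x - P.γ * (∫ s in (0 : ℝ)..t, Dis s) + (∫ s in (0 : ℝ)..t, W s) + _
  change H (z t - ((0 : Fin N → ℝ), η t)) = H x + ∫ s in (0 : ℝ)..t, (W s - P.γ * Dis s) at hid
  rw [hzt, hid, hsplit]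
  ring

/-- **Grönwall for the smooth part**: for `C¹` potentials with `γ ≥ 0`, if the linear energy bound
`∑_i |∂_{q_i}H(y)| + 2γ ∑_i |p_i| ≤ a (H(y) + d)` holds at every `y`, then along a continuous
solution `z` of `z(t) = x + (0, η(t)) + ∫₀ᵗ Y(z)` with `‖η‖ ≤ M` on `[0, T]`,
`H(z(t) - (0, η(t))) + d ≤ (H(x) + d) e^{a M t}` on `[0, T]` (the derivative of `H∘y + d` is
`DH(y)·Y(y.1, y.2 + η) ≤ ‖η‖ (∑|∂_qH| + 2γ∑|ȳ|) ≤ a M (H∘y + d)`).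
[cite: CuneoEckmannHairerReyBellet2018, §5 p. 11] -/
theorem hamiltonian_smoothPart_add_le_mul_exp (hU : ∀ i, ContDiff ℝ 1 (P.U i))
    (hV : ∀ i, ContDiff ℝ 1 (P.V i)) (hγ : 0 ≤ P.γ) {a d : ℝ}
    (hlin : ∀ y : PhaseSpace N, (∑ i, |partialQ i (P.hamiltonian N) y|) + 2 * P.γ * ∑ i, |y.2 i| ≤
      a * (P.hamiltonian N y + d))
    {x : PhaseSpace N} {η : ℝ → Fin N → ℝ} {z : ℝ → PhaseSpace N} (hzc : Continuous z)
    {T M : ℝ} (hM : ∀ t ∈ Icc 0 T, ‖η t‖ ≤ M)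
    (hz : IsIntegralSolutionOn (P.langevinDrift N) (fun t => x + ((0 : Fin N → ℝ), η t)) z T) :
    ∀ t ∈ Icc 0 T, P.hamiltonian N (z t - ((0 : Fin N → ℝ), η t)) + d ≤
      (P.hamiltonian N x + d) * Real.exp (a * M * t) := by
  intro t ht
  set H := P.hamiltonian N with hHdef
  set Y := P.langevinDrift N with hYdef
  have hT : 0 ≤ T := ht.1.trans ht.2
  have hM0 : 0 ≤ M := (norm_nonneg _).trans (hM 0 ⟨le_rfl, hT⟩)
  have hH1 : ContDiff ℝ 1 H := P.contDiff_hamiltonian N hU hV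
  have hHd : Differentiable ℝ H := hH1.differentiable one_ne_zero
  have hYc : Continuous Y := P.continuous_langevinDrift_of_contDiff hU hV N
  set y : ℝ → PhaseSpace N := fun s => x + ∫ r in (0 : ℝ)..s, Y (z r) with hydef
  have hy_deriv : ∀ s, HasDerivAt y (Y (z s)) s := fun s => by
    have h1 : HasDerivAt (fun u => ∫ r in (0 : ℝ)..u, Y (z r)) (Y (z s)) s :=
      ((hYc.comp hzc).integral_hasStrictDerivAt 0 s).hasDerivAt
    exact h1.const_add x
  have hy_eq : ∀ s ∈ Icc 0 T, y s = z s - ((0 : Fin N → ℝ), η s) := fun s hs =>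
    (P.smoothPart_eq_add_integral hz hs).symm
  have hz_y : ∀ s ∈ Icc 0 T, z s = ((y s).1, (y s).2 + η s) := fun s hs => by
    rw [hy_eq s hs]
    ext i <;> simp
  set f : ℝ → ℝ := fun s => H (y s) + d with hfdef
  have hf_deriv : ∀ s, HasDerivAt f (fderiv ℝ H (y s) (Y (z s))) s := fun s =>
    ((hHd (y s)).hasFDerivAt.comp_hasDerivAt s (hy_deriv s)).add_const d
  have hf_cont : Continuous f := continuous_iff_continuousAt.2 fun s => (hf_deriv s).continuousAt
  have hbound : ∀ s ∈ Ico 0 T, fderiv ℝ H (y s) (Y (z s)) ≤ (a * M) * f s + 0 := by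
    intro s hs
    have hs' : s ∈ Icc 0 T := ⟨hs.1, hs.2.le⟩
    rw [hz_y s hs']
    have h := P.fderiv_hamiltonian_drift_le hU hV hγ (y s) (η s)
    have hsc := hlin (y s)
    have hηs : ‖η s‖ ≤ M := hM s hs'
    have hnn : 0 ≤ (∑ i, |partialQ i H (y s)|) + 2 * P.γ * ∑ i, |(y s).2 i| := by
      have : 0 ≤ ∑ i, |partialQ i H (y s)| := Finset.sum_nonneg fun i _ => abs_nonneg _
      have : 0 ≤ ∑ i, |(y s).2 i| := Finset.sum_nonneg fun i _ => abs_nonneg _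
      positivity
    calc fderiv ℝ H (y s) (Y ((y s).1, (y s).2 + η s))
        ≤ ‖η s‖ * ((∑ i, |partialQ i H (y s)|) + 2 * P.γ * ∑ i, |(y s).2 i|) := h
      _ ≤ M * (a * (H (y s) + d)) := mul_le_mul hηs hsc hnn hM0
      _ = (a * M) * f s + 0 := by simp only [hfdef]; ring
  have hf0 : f 0 ≤ H x + d := by simp [hfdef, hydef]
  have hG := le_gronwallBound_of_liminf_deriv_right_le (f := f)
    (f' := fun s => fderiv ℝ H (y s) (Y (z s))) (δ := H x + d) (K := a * M) (ε := 0) (a := 0)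
    (b := T) hf_cont.continuousOn (fun s _ r hr => ?_) hf0 hbound t ht
  · rw [sub_zero, gronwallBound_ε0] at hG
    have hfin : f t = H (z t - ((0 : Fin N → ℝ), η t)) + d := by
      show H (y t) + d = _
      rw [hy_eq t ht]
    rw [hfin] at hG
    exact hG
  · have := ((hf_deriv s).hasDerivWithinAt (s := Ici s)).liminf_right_slope_le hr
    refine this.mono fun w hw => ?_
    rwa [slope_def_field, div_eq_inv_mul] at hw

/-! ### The model-free flow of a uniformly confining chain is such a path -/

namespace UniformlyConfining

variable {P}

/-- A momentum vector `(0, e)` lies in the noise subspace of the confined drift. [folklore] -/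
theorem momentumNoise_mem_noise (hP : P.UniformlyConfining) (N : ℕ) (e : Fin N → ℝ) :
    (((0 : Fin N → ℝ), e) : PhaseSpace N) ∈ (hP.confinedDrift N).noise :=
  mem_momentumSubspace.2 rfl

/-- **The driven flow solves the integral equation**: `z = drivenFlow (P.langevinDrift N) x (0, η)`
satisfies `z(t) = x + (0, η(t)) + ∫₀ᵗ Y(z)` on every `[0, T]` (`η` continuous). [folklore] -/
theorem isIntegralSolutionOn_drivenFlow (hP : P.UniformlyConfining) (N : ℕ) (x : PhaseSpace N)
    {η : ℝ → Fin N → ℝ} (hη : Continuous η) (T : ℝ) :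
    IsIntegralSolutionOn (P.langevinDrift N) (fun t => x + ((0 : Fin N → ℝ), η t))
      (drivenFlow (P.langevinDrift N) x fun s => ((0 : Fin N → ℝ), η s)) T :=
  (hP.confinedDrift N).toConfinedDrift.isIntegralSolutionOn_flow x (continuous_const.prodMk hη)
    (fun s => hP.momentumNoise_mem_noise N (η s)) T

/-- The driven flow `drivenFlow (P.langevinDrift N) x (0, η)` is continuous in time (`η` continuous).
[folklore] -/
theorem continuous_drivenFlow (hP : P.UniformlyConfining) (N : ℕ) (x : PhaseSpace N)
    {η : ℝ → Fin N → ℝ} (hη : Continuous η) :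
    Continuous (drivenFlow (P.langevinDrift N) x fun s => ((0 : Fin N → ℝ), η s)) :=
  (hP.confinedDrift N).toConfinedDrift.continuous_flow x (continuous_const.prodMk hη)
    fun s => hP.momentumNoise_mem_noise N (η s)

end UniformlyConfining

end SiteChain

end Literature.MathematicalPhysics.KineticTheory.HeatConduction
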